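import Mathlib
import HarnessLib
import Summits.Ventures.LatticeQCDFlow.Scaling.SU2IdentityFlowVolumeLaw
import Summits.Ventures.LatticeQCDFlow.Scaling.TiltAcceptanceCouplingMonotone

/-!
# LatticeQCDFlow / Scaling — the untrained factorised SU(2) sampler (class-angle chart): the
# acceptance `acc_V(β)` is NON-INCREASING in `β ≥ 0` and non-decreasing in `β ≤ 0`

HONEST FRAMING: exact (Metropolis-corrected) sampling algorithms for lattice gauge theory;
figures of merit are autocorrelation/cost numbers at stated couplings and volumes; no
continuum-physics claim.

Venture `LatticeQCDFlow` (cell pub-lqcd), topic `Scaling`; FANOUT row 3 (`s0-u1-a`, S0-B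
implementation A, GEN-17).  COROLLARY (no new estimate) of row 3's general tilt theorem
`Scaling/TiltAcceptanceCouplingMonotone.tiltIMH_meanAccept_antitoneOn` (imported) for the
factorised SU(2) model of `Scaling/SU2IdentityFlowVolumeLaw` (GEN-12, imported): `V = |ι|`
independent class angles `α ∈ (0, π]`, Haar class density `(2/π) sin² α`, one-plaquette Wilson class
density `sin² α e^{β cos α}/Z₂(β)` (`Z₂ = onePlaquetteZSU2`).  GEN-16 listed the SU(2) class-angle
analogues as open because the Haar class density is not constant; the general theorem carries an
arbitrary proposal density `q ≥ 0`, so the Wilson class law is the tilt of `Q = ∏ (2/π) sin²` by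
`β·Σ cos` and nothing more is needed.  NO definition is introduced.

* `su2IdentityFlow_tilt_facts` (`Q ≥ 0` measurable, `T = Σ cos` measurable, `Q e^{γT}` integrable,
  `∫ Q e^{γT} = ((2/π)Z₂(γ))^V > 0`), `su2Wilson_prod_eq_tilt` (the product Wilson class density is
  `Q e^{βT}/((2/π)Z₂(β))^V`), `su2IdentityFlow_meanAccept_eq_ratio` (the acceptance of
  `su2IdentityFlow_meanAccept_mem_Icc` in the ratio form, via `tiltIMH_meanAccept_density_eq`);
* **`su2IdentityFlow_meanAccept_antitoneOn`** — `acc_V` is NON-INCREASING on `[0, ∞)`;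
  **`su2IdentityFlow_meanAccept_monotoneOn`** — non-decreasing on `(−∞, 0]`.

Reading (value-free): the zero-training SU(2) row degrades monotonically in the coupling exactly as
the U(1) and general-Wilson rows do (`Scaling/IdentityFlowAcceptanceCouplingMonotone`).  NOT CLAIMED:
strictness and the holding-time law in this chart (the class density vanishes at the endpoints, outside
the positive-density hypotheses of `…CouplingStrict` / `…HoldingTimeCouplingMonotone`); the SU(2)
torus; any value at the cell's couplings; nothing re-scored, SEALED.md untouched.
-/

noncomputable section

namespace Summit.Ventures.LatticeQCDFlow.Theory2

open MeasureTheory Real Set Finset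
open Summit.Ventures.LatticeQCDFlow.Scoring (onePlaquetteZSU2 onePlaquetteZSU2_pos)

variable {ι : Type*} [Fintype ι]

/-- The Haar class proposal density `Q(x) = ∏ᵢ (2/π) sin²(xᵢ)` and the tilt statistic
`T(x) = Σᵢ cos(xᵢ)`: the hypotheses of `Scaling/TiltAcceptanceCouplingMonotone` on
`Lebesgue^{⊗V}` restricted to `(0, π]^V`, with `∫ Q e^{γT} = ((2/π)·Z₂(γ))^V > 0`. [ours] -/
theorem su2IdentityFlow_tilt_facts :
    (∀ x : ι → ℝ, 0 ≤ ∏ i, 2 / π * Real.sin (x i) ^ 2) ∧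
    (Measurable fun x : ι → ℝ => ∏ i, 2 / π * Real.sin (x i) ^ 2) ∧
    (Measurable fun x : ι → ℝ => ∑ i, Real.cos (x i)) ∧
    (∀ γ : ℝ, Integrable (fun x : ι → ℝ => (∏ i, 2 / π * Real.sin (x i) ^ 2)
        * Real.exp (γ * ∑ i, Real.cos (x i))) (Measure.pi fun _ : ι => volume.restrict (Ioc (0 : ℝ) π))) ∧
    (∀ γ : ℝ, ∫ x, (∏ i, 2 / π * Real.sin (x i) ^ 2) * Real.exp (γ * ∑ i, Real.cos (x i))
        ∂(Measure.pi fun _ : ι => volume.restrict (Ioc (0 : ℝ) π)) = (2 / π * onePlaquetteZSU2 γ) ^ Fintype.card ι) := by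
  set ν : Measure ℝ := volume.restrict (Ioc (0 : ℝ) π) with hν
  have e : ∀ γ (x : ι → ℝ), (∏ i, 2 / π * Real.sin (x i) ^ 2) * Real.exp (γ * ∑ i, Real.cos (x i))
      = ∏ i, (2 / π * (Real.sin (x i) ^ 2 * Real.exp (γ * Real.cos (x i)))) := by
    intro γ x
    rw [mul_sum, Real.exp_sum, ← prod_mul_distrib]
    exact prod_congr rfl fun i _ => by ring
  have h1 : ∀ γ : ℝ, Integrable (fun α : ℝ => 2 / π * (Real.sin α ^ 2 * Real.exp (γ * Real.cos α))) ν :=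
    fun γ => (integrableOn_sin_sq_mul_exp γ).const_mul _
  refine ⟨fun x => prod_nonneg fun i _ => by positivity,
    Finset.measurable_prod _ fun i _ =>
      measurable_const.mul ((Real.measurable_sin.comp (measurable_pi_apply i)).pow_const 2),
    Finset.measurable_sum _ fun i _ => Real.measurable_cos.comp (measurable_pi_apply i),
    fun γ => ?_, fun γ => ?_⟩
  · have h := Integrable.fintype_prod_dep (μ := fun _ : ι => ν) fun _ => h1 γ
    exact h.congr (ae_of_all _ fun x => by simp only; rw [e])
  · simp_rw [e]
    rw [integral_fintype_prod_eq_prod (μ := fun _ : ι => ν)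
      (fun (_ : ι) (α : ℝ) => 2 / π * (Real.sin α ^ 2 * Real.exp (γ * Real.cos α))), prod_const,
      card_univ, hν, integral_const_mul, integral_Ioc_sin_sq_mul_exp]

/-- The SU(2) Wilson class density is the tilt of the Haar class density:
`∏ᵢ sin²(xᵢ)e^{β cos xᵢ}/Z₂(β) = Q(x)·e^{βT(x)}/((2/π)Z₂(β))^V`. [ours] -/
theorem su2Wilson_prod_eq_tilt (β : ℝ) (x : ι → ℝ) :
    ∏ i, Real.sin (x i) ^ 2 * Real.exp (β * Real.cos (x i)) / onePlaquetteZSU2 β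
      = (∏ i, 2 / π * Real.sin (x i) ^ 2) * Real.exp (β * ∑ i, Real.cos (x i))
          / (2 / π * onePlaquetteZSU2 β) ^ Fintype.card ι := by
  have hZ := (onePlaquetteZSU2_pos β).ne'
  rw [mul_sum, Real.exp_sum, ← prod_mul_distrib, ← card_univ, ← prod_const, ← prod_div_distrib]
  exact prod_congr rfl fun i _ => by field_simp

/-- The SU(2) `V`-plaquette acceptance of `Scaling/SU2IdentityFlowVolumeLaw` in the ratio form of
`Scaling/TiltAcceptanceCouplingMonotone` (`ν = Lebesgue^{⊗V}` on `(0, π]^V`, `q = Q`, `T = Σ cos`).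
[ours] -/
theorem su2IdentityFlow_meanAccept_eq_ratio (β : ℝ) :
    ∫ x, ∫ x', min ((∏ i : ι, Real.sin (x i) ^ 2 * Real.exp (β * Real.cos (x i)) / onePlaquetteZSU2 β)
          * ∏ i : ι, (2 / π * Real.sin (x' i) ^ 2))
        ((∏ i : ι, Real.sin (x' i) ^ 2 * Real.exp (β * Real.cos (x' i)) / onePlaquetteZSU2 β)
          * ∏ i : ι, (2 / π * Real.sin (x i) ^ 2))
        ∂(Measure.pi fun _ : ι => volume.restrict (Ioc (0 : ℝ) π))
        ∂(Measure.pi fun _ : ι => volume.restrict (Ioc (0 : ℝ) π))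
      = (∫ x, ∫ x', (∏ i : ι, 2 / π * Real.sin (x i) ^ 2) * (∏ i : ι, 2 / π * Real.sin (x' i) ^ 2)
            * min (Real.exp (β * ∑ i, Real.cos (x i))) (Real.exp (β * ∑ i, Real.cos (x' i)))
          ∂(Measure.pi fun _ : ι => volume.restrict (Ioc (0 : ℝ) π))
          ∂(Measure.pi fun _ : ι => volume.restrict (Ioc (0 : ℝ) π)))
        / ∫ x, (∏ i : ι, 2 / π * Real.sin (x i) ^ 2) * Real.exp (β * ∑ i, Real.cos (x i))
          ∂(Measure.pi fun _ : ι => volume.restrict (Ioc (0 : ℝ) π)) := by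
  obtain ⟨hq, -, -, -, hM⟩ := su2IdentityFlow_tilt_facts (ι := ι)
  have hMpos : ∀ γ : ℝ, 0 < ∫ x, (∏ i : ι, 2 / π * Real.sin (x i) ^ 2) * Real.exp (γ * ∑ i, Real.cos (x i))
      ∂(Measure.pi fun _ : ι => volume.restrict (Ioc (0 : ℝ) π)) := fun γ => by
    rw [hM]; exact pow_pos (mul_pos (by positivity) (onePlaquetteZSU2_pos γ)) _
  rw [← tiltIMH_meanAccept_density_eq hq hMpos β]
  simp_rw [hM, su2Wilson_prod_eq_tilt]

/-- **THE UNTRAINED FACTORISED SU(2) SAMPLER: `acc_V(β)` IS NON-INCREASING IN `β ≥ 0`** — the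
equilibrium acceptance of Haar-class proposals against `V` independent SU(2) Wilson plaquettes
(row 3's `Scaling/SU2IdentityFlowVolumeLaw.su2IdentityFlow_meanAccept_mem_Icc`), every finite
plaquette set. [ours] -/
theorem su2IdentityFlow_meanAccept_antitoneOn :
    AntitoneOn (fun β : ℝ => ∫ x, ∫ x',
        min ((∏ i : ι, Real.sin (x i) ^ 2 * Real.exp (β * Real.cos (x i)) / onePlaquetteZSU2 β)
            * ∏ i : ι, (2 / π * Real.sin (x' i) ^ 2))
          ((∏ i : ι, Real.sin (x' i) ^ 2 * Real.exp (β * Real.cos (x' i)) / onePlaquetteZSU2 β)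
            * ∏ i : ι, (2 / π * Real.sin (x i) ^ 2))
        ∂(Measure.pi fun _ : ι => volume.restrict (Ioc (0 : ℝ) π))
        ∂(Measure.pi fun _ : ι => volume.restrict (Ioc (0 : ℝ) π))) (Ici 0) := by
  obtain ⟨hq, hqm, hTm, hint, hM⟩ := su2IdentityFlow_tilt_facts (ι := ι)
  have hMpos : ∀ γ : ℝ, 0 ≤ γ → 0 < ∫ x, (∏ i : ι, 2 / π * Real.sin (x i) ^ 2)
      * Real.exp (γ * ∑ i, Real.cos (x i)) ∂(Measure.pi fun _ : ι => volume.restrict (Ioc (0 : ℝ) π)) :=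
    fun γ _ => by rw [hM]; exact pow_pos (mul_pos (by positivity) (onePlaquetteZSU2_pos γ)) _
  have h := tiltIMH_meanAccept_antitoneOn hq hqm hTm (fun γ _ => hint γ) hMpos
  intro β hβ β' hβ' hββ'
  simp only [su2IdentityFlow_meanAccept_eq_ratio]
  exact h hβ hβ' hββ'

/-- **… AND NON-DECREASING IN `β ≤ 0`.** [ours] -/
theorem su2IdentityFlow_meanAccept_monotoneOn :
    MonotoneOn (fun β : ℝ => ∫ x, ∫ x',
        min ((∏ i : ι, Real.sin (x i) ^ 2 * Real.exp (β * Real.cos (x i)) / onePlaquetteZSU2 β)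
            * ∏ i : ι, (2 / π * Real.sin (x' i) ^ 2))
          ((∏ i : ι, Real.sin (x' i) ^ 2 * Real.exp (β * Real.cos (x' i)) / onePlaquetteZSU2 β)
            * ∏ i : ι, (2 / π * Real.sin (x i) ^ 2))
        ∂(Measure.pi fun _ : ι => volume.restrict (Ioc (0 : ℝ) π))
        ∂(Measure.pi fun _ : ι => volume.restrict (Ioc (0 : ℝ) π))) (Iic 0) := by
  obtain ⟨hq, hqm, hTm, hint, hM⟩ := su2IdentityFlow_tilt_facts (ι := ι)
  have hMpos : ∀ γ : ℝ, γ ≤ 0 → 0 < ∫ x, (∏ i : ι, 2 / π * Real.sin (x i) ^ 2)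
      * Real.exp (γ * ∑ i, Real.cos (x i)) ∂(Measure.pi fun _ : ι => volume.restrict (Ioc (0 : ℝ) π)) :=
    fun γ _ => by rw [hM]; exact pow_pos (mul_pos (by positivity) (onePlaquetteZSU2_pos γ)) _
  have h := tiltIMH_meanAccept_monotoneOn hq hqm hTm (fun γ _ => hint γ) hMpos
  intro β hβ β' hβ' hββ'
  simp only [su2IdentityFlow_meanAccept_eq_ratio]
  exact h hβ hβ' hββ'

end Summit.Ventures.LatticeQCDFlow.Theory2
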